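import Literature.MathematicalPhysics.QuantumFieldTheory.Balaban1983to89.BlockAveraging
import Literature.MathematicalPhysics.QuantumFieldTheory.Balaban1983to89.B15PrelimIntegrations

/-!
# B13AvgCorrStokes — row NE5, κ-DISCHARGE programme (T4-DAG §8 Q49 (a′), dagwriter l.23165; design note
# `HOME/t4/b2b-balaban-t4-ne5-p1/g39/KAPPA-NE5-DESIGN.md` §3), leaf κ-L1 «FINEST STOKES», file 1∕2: THE SWAP ∕ CANCELLATION CALCULUS OF
# LATTICE HOLONOMIES — ONE ADJACENT SWAP OF LETTERS COSTS AT MOST ONE PLAQUETTE VARIABLE, A BLOCK PAST A BLOCK COSTS `|A|·|B|`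

Cell `pub-balaban`, unit `b2b-balaban-t4-ne5-formalise-leaf-01` (NE5 formalisation swarm LEAF PROVER 01, gen 22; leaf κ-L1 of the
owner's κ leaf cut, journal CLAIM l.23453).  Summits-side NEW WORK under the LEAN PLACEMENT RULE: a [folklore] group-valued lattice
Stokes bound on OUR torus walk objects (`T4Continuum.walk` ∕ `holAt`, the loop words `loopWord` of `BlockAveraging`); 0 `def`, no
`Prop`-valued fact minted, nothing printed asserted, no citation tag.  HONEST FRAMING: rung (B)+1 of the FINITE-VOLUME T⁴ programme —
NOT infinite volume, NOT a mass gap, NOT the Clay problem, NOT a proof of NE5 (NOT PRINTED; GAPS G-t4-U3-1); nothing of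
[Balaban1985Averaging] ∕ [Balaban1987RG1] is instantiated or discharged here.  HONEST DEPENDENCY (cell, verbatim): continuum YM on T⁴ ⇐
BetaPertH ∧ nine spine estimates (0/9 proved); BetaPertH ⇐ (D1) ∧ (D4) ∧ CAP+tail; G-an2-4 gates asym, D1 and NE2/3/4.

WHY.  The κ-letter of the substrate's W-25a∕b (`hκ : dist1 (corr ℰ U_i c) ≤ κ∕ℓ²`, GAPS § G-ne5p1-Javg-reg) is discharged, on the road of
record (design note §2, (K1-b)), from a NON-ABELIAN STOKES bound `dist1 (hol w) ≤ area(w) · sup_p dist1 (V ∂p)` for the loop words of (0.4)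
read on the finest lattice, and the finest-plaquette letter κ-L2 (`B13AvgCorrPlaquette`).  This file is the former, proved by
ABELIANISATION COST rather than by an explicit spanning surface: swapping two adjacent letters of a word changes the holonomy by a conjugate
of one plaquette variable (or not at all, for letters of the same axis), cancelling an adjacent pair `l, l⁻¹` changes nothing, and a word
is contracted to the empty word by counting swaps.  Throughout, `s` bounds the ORDERED-PAIR plaquette variables
`U⟨y,μ⟩ U⟨y+e_μ,ν⟩ U⟨y+e_ν,μ⟩⁻¹ U⟨y,ν⟩⁻¹` (`μ ≠ ν`; the shape of κ-L2's `norm_plaquette_sub_one_le_of_reg (k μ ν i)`), and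
`0 ≤ s`; §3 converts the tree's `GaugeField.plaqHol` (`μ < ν`) bound into this shape.
* §0 `dist1` bookkeeping for the defect `dist1 (a · b⁻¹)` (symmetry, framing by a common prefix∕suffix; the triangle inequality is the
  tree's `B15.PrelimIntegrations.dist1_fluct_le`, imported).
* §1 two letters: `walkEnd_pair_comm`; THE SWAP DEFECT `dist1_holAt_pair_swap`
  (`dist1 (hol_y [l₁,l₂] · (hol_y [l₂,l₁])⁻¹) ≤ s`); the cancelling pair `holAt_walk_flip_pair` (`hol_y [l, l⁻¹] = 1`, back at `y`).
* §2 words in context: `dist1_holAt_swap` (one adjacent swap inside `w₁ ++ _ ++ w₂` costs `≤ s`), `holAt_walk_cancel` (`l, l⁻¹` deleted),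
  `dist1_holAt_letter_past` (a letter past a block `B`: `≤ |B|·s`), `dist1_holAt_block_past` (a block `A` past a block `B`: `≤ |A|·|B|·s`),
  `holAt_walk_cancel_runs` (`l^k (l⁻¹)^k` deleted), `dist1_holAt_prefix` (a common prefix is free).
* file 2∕2 `B13AvgCorrStokesLoop` assembles these into the bound for the loop words of (0.4):
  `dist1 (holAt U (walk x (loopWord L′ μ n σ σ′))) ≤ (L′·|n|₁ + |n|₁²∕2)·s` for every base site and level, and
  `dist1 (loopHol U c i) ≤ (d∕2 + d²∕8)·L²·s` at a coarse bond.
* §3 `plaq_pair_bound_of_plaqHol` : `(∀ p, dist1 (plaqHol U p) ≤ s) →` the ordered-pair hypothesis.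
0 sorry; axioms ⊆ {propext, Classical.choice, Quot.sound}.
-/

noncomputable section

namespace Summit.QuantumFields.BalabanUV.T4Continuum.B13AvgCorrStokes

open Literature.MathematicalPhysics.QuantumFieldTheory.Balaban1983to89
open Literature.MathematicalPhysics.QuantumFieldTheory.Balaban1983to89.T4Continuum
open Literature.MathematicalPhysics.QuantumFieldTheory.Balaban1983to89.B15.PrelimIntegrations (dist1_fluct_le)

variable {P : Params} {j : ℕ} {G : Type*} [GaugeGroup G]

/-! ## §0 `dist1` bookkeeping for the defect `dist1 (a · b⁻¹)` -/

/-- [folklore] the defect is symmetric. -/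
theorem dist1_mul_inv_comm (a b : G) : dist1 (a * b⁻¹) = dist1 (b * a⁻¹) := by
  rw [← GaugeGroup.dist1_inv (a * b⁻¹), mul_inv_rev, inv_inv]

/-- [folklore] `dist1 a ≤ dist1 (a b⁻¹) + dist1 b`. -/
theorem dist1_le_dist1_mul_inv_add (a b : G) : dist1 a ≤ dist1 (a * b⁻¹) + dist1 b :=
  calc dist1 a = dist1 (a * b⁻¹ * b) := by rw [inv_mul_cancel_right]
    _ ≤ dist1 (a * b⁻¹) + dist1 b := GaugeGroup.dist1_mul_le _ _

/-- [folklore] a common prefix `h` and a common suffix `k` do not change the defect (conjugation invariance). -/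
theorem dist1_conj_frame (h a b k : G) : dist1 (h * a * k * (h * b * k)⁻¹) = dist1 (a * b⁻¹) := by
  have e : h * a * k * (h * b * k)⁻¹ = h * (a * b⁻¹) * h⁻¹ := by group
  rw [e, GaugeGroup.dist1_conj]

/-- [folklore] a common prefix does not change the defect. -/
theorem dist1_prefix_frame (h a b : G) : dist1 (h * a * (h * b)⁻¹) = dist1 (a * b⁻¹) := by
  have e : h * a * (h * b)⁻¹ = h * (a * b⁻¹) * h⁻¹ := by group
  rw [e, GaugeGroup.dist1_conj]

/-! ## §1 Two letters: the swap defect is one plaquette variable (or `1`), the pair `l, l⁻¹` is trivial -/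

/-- [folklore] `x + a + b = x + b + a`: the end of a two-letter walk does not depend on the order of the letters. -/
theorem walkEnd_pair_comm (y : Site P j) (l₁ l₂ : Letter P.d) : walkEnd y [l₁, l₂] = walkEnd y [l₂, l₁] := by
  funext ν
  rw [walkEnd_apply, walkEnd_apply]
  congr 2
  simp only [netDisp, List.map_cons, List.map_nil, List.sum_cons, List.sum_nil]
  ring

/-- [folklore] **THE SWAP DEFECT.**  If every ordered-pair plaquette variable `U⟨y,μ⟩ U⟨y+e_μ,ν⟩ U⟨y+e_ν,μ⟩⁻¹ U⟨y,ν⟩⁻¹` (`μ ≠ ν`) is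
within `s ≥ 0` of `1`, then for any two letters `l₁, l₂` and any base site `y` the holonomies of the two-letter walks `l₁ l₂` and
`l₂ l₁` from `y` differ by at most `s`: their quotient is `1` when the letters share an axis, and a conjugate of one plaquette variable
(or of its inverse) otherwise. -/
theorem dist1_holAt_pair_swap (U : GaugeField P j G) {s : ℝ} (hs0 : 0 ≤ s)
    (hs : ∀ (y : Site P j) (μ ν : Fin P.d), μ ≠ ν →
      dist1 (U ⟨y, μ⟩ * U ⟨y.shift μ, ν⟩ * (U ⟨y.shift ν, μ⟩)⁻¹ * (U ⟨y, ν⟩)⁻¹) ≤ s)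
    (y : Site P j) (l₁ l₂ : Letter P.d) :
    dist1 (holAt U (walk y [l₁, l₂]) * (holAt U (walk y [l₂, l₁]))⁻¹) ≤ s := by
  obtain ⟨μ, b₁⟩ := l₁
  obtain ⟨ν, b₂⟩ := l₂
  by_cases hμν : μ = ν
  · subst hμν
    cases b₁ <;> cases b₂ <;>
      simp [walk, holAt_cons, holAt_nil, Site.unshift_shift, GaugeGroup.dist1_one, hs0]
  · cases b₁ <;> cases b₂
    · -- `(μ,−), (ν,−)`: base the plaquette at `z = y − e_μ − e_ν`
      obtain ⟨z, rfl⟩ : ∃ z, y = (z.shift μ).shift ν := ⟨(y.unshift ν).unshift μ, by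
        rw [Site.shift_unshift, Site.shift_unshift]⟩
      have key := hs z μ ν hμν
      rw [← GaugeGroup.dist1_conj _ ((U ⟨z, μ⟩ * U ⟨z.shift μ, ν⟩)⁻¹)] at key
      simp only [walk, holAt_cons, holAt_nil, mul_one, Bool.false_eq_true, if_false,
        T4ReflectionCone.shift_shift_unshift, Site.unshift_shift]
      convert key using 2
      group
    · -- `(μ,−), (ν,+)`: base the plaquette at `z = y − e_μ`, pair `(ν, μ)`
      obtain ⟨z, rfl⟩ : ∃ z, y = z.shift μ := ⟨y.unshift μ, by rw [Site.shift_unshift]⟩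
      have key := hs z ν μ (Ne.symm hμν)
      rw [← GaugeGroup.dist1_conj _ (U ⟨z, μ⟩)⁻¹] at key
      simp only [walk, holAt_cons, holAt_nil, mul_one, Bool.false_eq_true, if_false, if_true,
        T4ReflectionCone.shift_shift_unshift, Site.unshift_shift]
      convert key using 2
      group
    · -- `(μ,+), (ν,−)`: base the plaquette at `z = y − e_ν`, pair `(ν, μ)`
      obtain ⟨z, rfl⟩ : ∃ z, y = z.shift ν := ⟨y.unshift ν, by rw [Site.shift_unshift]⟩
      have key := hs z ν μ (Ne.symm hμν)
      rw [← GaugeGroup.dist1_conj _ (U ⟨z, ν⟩)⁻¹] at key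
      simp only [walk, holAt_cons, holAt_nil, mul_one, Bool.false_eq_true, if_false, if_true,
        T4ReflectionCone.shift_shift_unshift, Site.unshift_shift]
      convert key using 2
      group
    · -- `(μ,+), (ν,+)`: the plaquette at `y`, pair `(μ, ν)`
      have key := hs y μ ν hμν
      simp only [walk, holAt_cons, holAt_nil, mul_one, if_true]
      convert key using 2
      group

/-- [folklore] **THE CANCELLING PAIR**: the walk `l, l⁻¹` from `y` has holonomy `1` and returns to `y`. -/
theorem holAt_walk_flip_pair (U : GaugeField P j G) (y : Site P j) (l : Letter P.d) :
    holAt U (walk y [l, l.flip]) = 1 ∧ walkEnd y [l, l.flip] = y := by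
  obtain ⟨μ, b⟩ := l
  cases b <;> simp [walk, walkEnd, holAt_cons, holAt_nil, Letter.flip, Site.unshift_shift, Site.shift_unshift]

/-! ## §2 Words in context: swaps, cancellations, letters and blocks moved past blocks -/

section Words

variable (U : GaugeField P j G) {s : ℝ} (hs0 : 0 ≤ s)
  (hs : ∀ (y : Site P j) (μ ν : Fin P.d), μ ≠ ν →
    dist1 (U ⟨y, μ⟩ * U ⟨y.shift μ, ν⟩ * (U ⟨y.shift ν, μ⟩)⁻¹ * (U ⟨y, ν⟩)⁻¹) ≤ s)

/-- [folklore] replacing a middle segment `m` by `m′` with the same end point changes the defect only through the middle: the common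
prefix and suffix are free. -/
theorem dist1_holAt_middle (x : Site P j) (w₁ m m' w₂ : List (Letter P.d))
    (hend : walkEnd (walkEnd x w₁) m' = walkEnd (walkEnd x w₁) m) :
    dist1 (holAt U (walk x (w₁ ++ (m ++ w₂))) * (holAt U (walk x (w₁ ++ (m' ++ w₂))))⁻¹)
      = dist1 (holAt U (walk (walkEnd x w₁) m) * (holAt U (walk (walkEnd x w₁) m'))⁻¹) := by
  rw [walk_append, walk_append, walk_append, walk_append, holAt_append, holAt_append, holAt_append, holAt_append,
    hend, ← mul_assoc, ← mul_assoc, dist1_conj_frame]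

/-- [folklore] a common prefix is free. -/
theorem dist1_holAt_prefix (x : Site P j) (A w w' : List (Letter P.d)) :
    dist1 (holAt U (walk x (A ++ w)) * (holAt U (walk x (A ++ w')))⁻¹)
      = dist1 (holAt U (walk (walkEnd x A) w) * (holAt U (walk (walkEnd x A) w'))⁻¹) := by
  rw [walk_append, walk_append, holAt_append, holAt_append, dist1_prefix_frame]

include hs0 hs in
/-- [folklore] **ONE ADJACENT SWAP COSTS AT MOST ONE PLAQUETTE**: `dist1 (hol(w₁ l₁ l₂ w₂) · hol(w₁ l₂ l₁ w₂)⁻¹) ≤ s`. -/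
theorem dist1_holAt_swap (x : Site P j) (w₁ w₂ : List (Letter P.d)) (l₁ l₂ : Letter P.d) :
    dist1 (holAt U (walk x (w₁ ++ l₁ :: l₂ :: w₂)) * (holAt U (walk x (w₁ ++ l₂ :: l₁ :: w₂)))⁻¹) ≤ s := by
  have e₁ : w₁ ++ l₁ :: l₂ :: w₂ = w₁ ++ ([l₁, l₂] ++ w₂) := rfl
  have e₂ : w₁ ++ l₂ :: l₁ :: w₂ = w₁ ++ ([l₂, l₁] ++ w₂) := rfl
  rw [e₁, e₂, dist1_holAt_middle U x w₁ [l₁, l₂] [l₂, l₁] w₂ (walkEnd_pair_comm _ l₂ l₁)]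
  exact dist1_holAt_pair_swap U hs0 hs _ l₁ l₂

/-- [folklore] **CANCELLATION**: deleting an adjacent pair `l, l⁻¹` does not change the holonomy. -/
theorem holAt_walk_cancel (x : Site P j) (w₁ w₂ : List (Letter P.d)) (l : Letter P.d) :
    holAt U (walk x (w₁ ++ l :: l.flip :: w₂)) = holAt U (walk x (w₁ ++ w₂)) := by
  have e : w₁ ++ l :: l.flip :: w₂ = w₁ ++ ([l, l.flip] ++ w₂) := rfl
  obtain ⟨h1, h2⟩ := holAt_walk_flip_pair U (walkEnd x w₁) l
  rw [e, walk_append, walk_append, holAt_append, holAt_append, h1, h2, one_mul, ← holAt_append, ← walk_append]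

include hs0 hs in
/-- [folklore] **A LETTER MOVED PAST A BLOCK** `B` costs at most `|B|` plaquettes. -/
theorem dist1_holAt_letter_past (x : Site P j) (l : Letter P.d) : ∀ (B w₁ w₂ : List (Letter P.d)),
    dist1 (holAt U (walk x (w₁ ++ l :: (B ++ w₂))) * (holAt U (walk x (w₁ ++ (B ++ l :: w₂))))⁻¹) ≤ B.length * s
  | [], w₁, w₂ => by simp [GaugeGroup.dist1_one]
  | b :: B, w₁, w₂ => by
    have h1 := dist1_holAt_swap U hs0 hs x w₁ (B ++ w₂) l b
    have h2 := dist1_holAt_letter_past x l B (w₁ ++ [b]) w₂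
    have e1 : w₁ ++ [b] ++ l :: (B ++ w₂) = w₁ ++ b :: l :: (B ++ w₂) := by simp
    have e2 : w₁ ++ [b] ++ (B ++ l :: w₂) = w₁ ++ (b :: B ++ l :: w₂) := by simp
    rw [e1, e2] at h2
    calc dist1 (holAt U (walk x (w₁ ++ l :: (b :: B ++ w₂))) * (holAt U (walk x (w₁ ++ (b :: B ++ l :: w₂))))⁻¹)
        ≤ dist1 (holAt U (walk x (w₁ ++ l :: b :: (B ++ w₂))) * (holAt U (walk x (w₁ ++ b :: l :: (B ++ w₂))))⁻¹)
          + dist1 (holAt U (walk x (w₁ ++ b :: l :: (B ++ w₂))) * (holAt U (walk x (w₁ ++ (b :: B ++ l :: w₂))))⁻¹) :=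
          dist1_fluct_le _ _ _
      _ ≤ s + B.length * s := add_le_add h1 h2
      _ = (b :: B).length * s := by push_cast [List.length_cons]; ring

include hs0 hs in
/-- [folklore] **A BLOCK `A` MOVED PAST A BLOCK `B`** costs at most `|A|·|B|` plaquettes. -/
theorem dist1_holAt_block_past (x : Site P j) (B : List (Letter P.d)) : ∀ (A w₁ w₂ : List (Letter P.d)),
    dist1 (holAt U (walk x (w₁ ++ (A ++ (B ++ w₂)))) * (holAt U (walk x (w₁ ++ (B ++ (A ++ w₂)))))⁻¹)
      ≤ A.length * B.length * s
  | [], w₁, w₂ => by simp [GaugeGroup.dist1_one]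
  | a :: A, w₁, w₂ => by
    have h1 := dist1_holAt_block_past x B A (w₁ ++ [a]) w₂
    have h2 := dist1_holAt_letter_past U hs0 hs x a B w₁ (A ++ w₂)
    have e1 : w₁ ++ [a] ++ (A ++ (B ++ w₂)) = w₁ ++ (a :: A ++ (B ++ w₂)) := by simp
    have e2 : w₁ ++ [a] ++ (B ++ (A ++ w₂)) = w₁ ++ a :: (B ++ (A ++ w₂)) := by simp
    have e3 : w₁ ++ (B ++ a :: (A ++ w₂)) = w₁ ++ (B ++ (a :: A ++ w₂)) := by simp
    rw [e1, e2] at h1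
    rw [e3] at h2
    calc dist1 (holAt U (walk x (w₁ ++ (a :: A ++ (B ++ w₂)))) * (holAt U (walk x (w₁ ++ (B ++ (a :: A ++ w₂)))))⁻¹)
        ≤ dist1 (holAt U (walk x (w₁ ++ (a :: A ++ (B ++ w₂)))) * (holAt U (walk x (w₁ ++ a :: (B ++ (A ++ w₂)))))⁻¹)
          + dist1 (holAt U (walk x (w₁ ++ a :: (B ++ (A ++ w₂)))) * (holAt U (walk x (w₁ ++ (B ++ (a :: A ++ w₂)))))⁻¹) :=
          dist1_fluct_le _ _ _
      _ ≤ A.length * B.length * s + B.length * s := add_le_add h1 h2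
      _ = (a :: A).length * B.length * s := by push_cast [List.length_cons]; ring

/-- [folklore] **RUN CANCELLATION**: `w₁ l^k (l⁻¹)^k w₂` and `w₁ w₂` have the same holonomy. -/
theorem holAt_walk_cancel_runs (x : Site P j) (l : Letter P.d) : ∀ (k : ℕ) (w₁ w₂ : List (Letter P.d)),
    holAt U (walk x (w₁ ++ (List.replicate k l ++ (List.replicate k l.flip ++ w₂)))) = holAt U (walk x (w₁ ++ w₂))
  | 0, w₁, w₂ => by simp
  | k + 1, w₁, w₂ => by
    have e : w₁ ++ (List.replicate (k + 1) l ++ (List.replicate (k + 1) l.flip ++ w₂))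
        = (w₁ ++ List.replicate k l) ++ l :: l.flip :: (List.replicate k l.flip ++ w₂) := by
      rw [List.replicate_succ', List.replicate_succ]; simp [List.append_assoc]
    rw [e, holAt_walk_cancel, List.append_assoc]
    exact holAt_walk_cancel_runs x l k w₁ w₂

end Words

/-! ## §3 From the tree's plaquette variables `plaqHol` (`μ < ν`) to the ordered-pair hypothesis -/

/-- [folklore] the ordered-pair plaquette variable for `μ > ν` is the inverse of `plaqHol` at the transposed plaquette, so a bound on
all `dist1 (plaqHol U p)` is a bound on all ordered pairs. -/
theorem plaq_pair_bound_of_plaqHol (U : GaugeField P j G) {s : ℝ}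
    (hp : ∀ p : Plaq P j, dist1 (GaugeField.plaqHol U p) ≤ s) (y : Site P j) (μ ν : Fin P.d) (hμν : μ ≠ ν) :
    dist1 (U ⟨y, μ⟩ * U ⟨y.shift μ, ν⟩ * (U ⟨y.shift ν, μ⟩)⁻¹ * (U ⟨y, ν⟩)⁻¹) ≤ s := by
  rcases lt_or_gt_of_ne hμν with h | h
  · exact hp ⟨y, μ, ν, h⟩
  · have key := hp ⟨y, ν, μ, h⟩
    rw [← GaugeGroup.dist1_inv] at key
    convert key using 2
    simp only [GaugeField.plaqHol]
    group

end Summit.QuantumFields.BalabanUV.T4Continuum.B13AvgCorrStokes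

end
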